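import Mathlib.Analysis.SpecialFunctions.SmoothTransition
import Literature.Geometry.Lorentzian.CauchyDevelopment
import Literature.Geometry.Lorentzian.KerrData
import Literature.Geometry.Lorentzian.LorentzianDistance
import Literature.Geometry.Lorentzian.KerrConvergence
import Literature.Geometry.Lorentzian.Geodesic
import HarnessLib

/-!
# Four named facts on the Kerr chart `{r > r₋}` behind the exact-Kerr bookkeeping of
# maximal developments of Kerr-shielded data

(family `gr`; named facts = statements only, D-0014; consumers: crux `TameCensorship` of
`FinalStateConjecture`, line `crush-the-swallowed-interior`, stub B `stub_exactKerrBookkeeping`,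
whose kernel-checked reduction to these facts lives in
`Summits/FinalStateConjecture/FinalStateConjecture/Theorems/PhotonSphereChannelsTameCensorshipExactKerr*.lean`.)

A **Kerr-shielded** datum `(X, h, k)` is an exact sub-extremal Kerr leaf outside a compact core: a
smooth open embedding `φ : Kerr.slice a r₁ → X` (`r₋ < r₁ < r₊`, `|a| < M`) with compact
`K = (range φ)ᶜ`, and the graph `ψ : y ↦ (T(r y), y)` of the bent height
`T(r) = χ(r/4M − 1) · (r*_{BL}(r) − r − const)` (`χ = Real.smoothTransition`; `T ≡ 0` on `r ≤ 4M`)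
into the ingoing Kerr–Schild chart `Kerr.region a r₁`, spacelike with future unit normal `ν`, such that
`φ^*h = ψ^*g_{M,a}` and `φ^*k = K_ν(ψ)` (route SwallowTheDatum of `FinalStateConjecture`, items
`ParametricKerrBurial` / `KerrShieldedSettles`). For a maximal vacuum Cauchy development
`𝒟 = (M, g, τ, ι, ν)` of such a datum the *exact part* is `E = J⁺(ιX) ∖ J⁺(ιK)`. The tree proves
(`KerrShieldedSettles.stub_collarEmbedsMGHD`, given MGHD existence) that the tapered collar
`W = {x ∈ Kerr.region a r₁ | 0 < x⁰ − T(r x) + (r x − r₁)/4}` is a vacuum Cauchy development of the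
leaf data and embeds into `𝒟` by a collar chart `χ' : W → M`. The four facts:

* `KerrLeafExactPartChart` — **the exact part of `𝒟` is a piece of Kerr**: `χ'` inverts and extends
  to an injective time-orientation preserving local isometry `χ : E' → Kerr.region a r₋` on an open
  `E' ⊇ E ∪ χ'(W)`. This is (given Choquet-Bruhat–Geroch uniqueness and the rigidity of development
  maps, both in the tree: `mghd_unique_cauchy`, `DataEmbedding.eq_of_comp_embed_eq`) the statement
  that the domain of dependence of the bent leaf in `{r > r₋}` is the MAXIMAL globally hyperbolic
  vacuum development of the leaf data — Choquet-Bruhat–Geroch 1969, Thm. 3; Hawking–Ellis 1973,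
  §7.6 (MGHD of a sub-datum); for the Kerr chart O'Neill 1995, §2.5–§2.7 and Chruściel 1991, §3.
* `KerrBlackHoleBoundedTimeSeparation` — **Boyer–Lindquist block II has finite timelike
  diameter**: `d(p, q) ≤ C(M, a)` whenever `r(p) < r₊`.
* `KerrBlackHoleNoCompleteNullRay` — **future-complete null geodesics of `{r > r₋}` do not meet
  `{r < r₊}`** (null geodesics of block II reach `{r = r₋}` at finite affine parameter).
* `KerrVisibleExteriorUniformCharts` — **uniformly bounded geometry of the visible exterior in
  Kerr–Schild coordinates**: orthonormalised coordinate balls of a fixed scale around every point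
  above the leaf that can still signal to `{r ≥ r₊}` stay in the collar `W`, with uniform `C³`
  bounds and `C⁰` deviation `≤ 1/2` from `η`.

Everything here is a `def … : Prop` (statement only, cited); nothing is proved. The bent height is
passed as a function `T` pinned by the hypothesis `T = (literal)`, verbatim as in the theses of
route SwallowTheDatum.

## References

* Y. Choquet-Bruhat, R. Geroch, *Global aspects of the Cauchy problem in general relativity*,
  Comm. Math. Phys. 14 (1969) 329–335, Thm. 3. [ChoquetBruhatGeroch1969CMP]
* S. W. Hawking, G. F. R. Ellis, *The large scale structure of space-time*, CUP 1973, §5.6, §6.5,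
  §7.6. [HawkingEllis1973CUP]
* B. O'Neill, *The geometry of Kerr black holes*, A K Peters 1995, Ch. 2, §2.4–§2.7; Ch. 4,
  §4.2–§4.3. [ONeill1995]
* P. T. Chruściel, *On uniqueness in the large of solutions of Einstein's equations ("strong cosmic
  censorship")*, Proc. CMA 27, ANU 1991, §3.
* M. Dafermos, G. Holzegel, I. Rodnianski, M. Taylor, *The non-linear stability of the
  Schwarzschild family of black holes*, arXiv:2104.08222, §1. [arXiv210408222]
-/

noncomputable section

open scoped Manifold ContDiff Topology ENNReal NNReal
open Set Bundle

namespace Literature.Geometry.Lorentzian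

/-- **The exact part of a maximal development of Kerr-shielded data is a piece of Kerr**
(`KerrLeafExactPartChart`, named fact). For a Kerr-shielded datum on `X` (sub-extremal `(M, a)`,
`r₋ < r₁ < r₊`, bent height `T` (pinned to its literal), compact `(range φ)ᶜ`, `φ` a smooth open
embedding of `Kerr.slice a r₁`, `ψ` the graph of `T∘r`, spacelike with future unit normal `ν`,
`φ^*h = ψ^*g_{M,a}` and `φ^*k = K_ν(ψ)` pointwise), a MAXIMAL vacuum Cauchy development
`𝒟 = (M, g, τ, ι, ν)` and a collar chart `χ' : Kerr.region a r₁ → M` which on the tapered collar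
`W = {0 < x⁰ − T(r x) + (r x − r₁)/4}` is smooth, an open embedding, isometric, time-orientation
preserving, with `χ' ∘ ψ = ι ∘ φ` and `dχ' ν = ν_𝒟 ∘ φ`: there are an OPEN `E' ⊆ M` containing the
exact part `J⁺(ιX) ∖ J⁺(ι (range φ)ᶜ)` and `χ : M → Kerr.region a r₋` which on `E'` is smooth,
injective, isometric (`g_{M,a}(dχ v, dχ w) = g(v, w)`) and time-orientation preserving
(`dχ τ` future for `−g♯dt*`), with `χ'(W) ⊆ E'` and `χ ∘ χ' = incl` on `W`. Given the uniqueness of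
the MGHD (Choquet-Bruhat–Geroch 1969, Thm. 3) and Hawking–Ellis 1973, §7.6 (developments of a
sub-datum map into the maximal development), this is the statement that the domain of dependence of
the bent leaf in the chart `{r > r₋}` (Boyer–Lindquist blocks I ∪ II, O'Neill 1995, §2.5–§2.7) is the
maximal globally hyperbolic vacuum development of the leaf data (Chruściel 1991, §3). Named fact
(statement only); users take `(h : KerrLeafExactPartChart)`.
[cite: ChoquetBruhatGeroch1969CMP, Thm. 3 (p. 332)] [cite: HawkingEllis1973CUP, §7.6 (pp. 249–251)]
[cite: ONeill1995, Ch. 2, §2.5–§2.7] -/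
def KerrLeafExactPartChart : Prop :=
  ∀ [Kerr.Facts] (X : Type) [TopologicalSpace X] [ChartedSpace E3 X]
    [IsManifold (𝓡 3) ((⊤ : ℕ∞) : WithTop ℕ∞) X] [T2Space X] [SecondCountableTopology X]
    [ConnectedSpace X] (D : InitialDataSet (𝓡 3) X) (M a r₁ : ℝ) (hM : 0 ≤ M) (T : ℝ → ℝ)
    (φ : Kerr.slice a r₁ → X) (ψ : Kerr.slice a r₁ → Kerr.region a r₁)
    (ν : NormalField 𝓘(ℝ, E4) ψ),
    |a| < M → Kerr.rMinus M a < r₁ → r₁ < Kerr.rPlus M a →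
    T = (fun r : ℝ ↦ Real.smoothTransition (r / (4 * M) - 1) *
      (((M) / Real.sqrt ((M) ^ 2 - (a) ^ 2)) * (Kerr.rPlus M a * Real.log (r - Kerr.rPlus M a) -
        Kerr.rMinus M a * Real.log (r - Kerr.rMinus M a)) -
      ((M) / Real.sqrt ((M) ^ 2 - (a) ^ 2)) * (Kerr.rPlus M a * Real.log ((4 * M) - Kerr.rPlus M a) -
        Kerr.rMinus M a * Real.log ((4 * M) - Kerr.rMinus M a)))) →
    IsCompact (Set.range φ)ᶜ → Topology.IsOpenEmbedding φ →
    ContMDiff 𝓘(ℝ, E3) (𝓡 3) ((⊤ : ℕ∞) : WithTop ℕ∞) φ →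
    (∀ y : Kerr.slice a r₁, (ψ y : E4) =
        E4.ofTimeSpace (T (Kerr.radius a (E4.ofTimeSpace 0 (y : E3)))) (y : E3)) →
    (Kerr.smoothMetric M a r₁).IsSpacelikeImmersion 𝓘(ℝ, E3) ψ →
    (Kerr.smoothMetric M a r₁).IsFutureUnitNormal 𝓘(ℝ, E3)
        ((Kerr.timeOrientation M a r₁ hM).ofLE le_top) ψ ν →
    (∀ (y : Kerr.slice a r₁) (v w : E3),
        D.h.inner (φ y) (mfderiv 𝓘(ℝ, E3) (𝓡 3) φ y v) (mfderiv 𝓘(ℝ, E3) (𝓡 3) φ y w) =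
          Kerr.bilin M a (ψ y : E4) (mfderiv 𝓘(ℝ, E3) 𝓘(ℝ, E4) ψ y v)
            (mfderiv 𝓘(ℝ, E3) 𝓘(ℝ, E4) ψ y w)) →
    (∀ [(Kerr.smoothMetric M a r₁).HasLeviCivita] (y : Kerr.slice a r₁) (v w : E3),
        D.k (φ y) (mfderiv 𝓘(ℝ, E3) (𝓡 3) φ y v) (mfderiv 𝓘(ℝ, E3) (𝓡 3) φ y w) =
          (Kerr.smoothMetric M a r₁).secondFundamentalForm 𝓘(ℝ, E3) ψ ν y v w) →
    ∀ 𝒟 : VacuumCauchyDevelopment D, 𝒟.IsMaximal →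
    ∀ χ' : Kerr.region a r₁ → 𝒟.carrier,
      ContMDiffOn 𝓘(ℝ, E4) (𝓡 4) ((⊤ : ℕ∞) : WithTop ℕ∞) χ'
        {x | 0 < (x : E4) 0 - T (Kerr.radius a (x : E4)) + (Kerr.radius a (x : E4) - r₁) / 4} →
      Topology.IsOpenEmbedding (Set.restrict {x : Kerr.region a r₁ |
        0 < (x : E4) 0 - T (Kerr.radius a (x : E4)) + (Kerr.radius a (x : E4) - r₁) / 4} χ') →
      (∀ x : Kerr.region a r₁,
        0 < (x : E4) 0 - T (Kerr.radius a (x : E4)) + (Kerr.radius a (x : E4) - r₁) / 4 →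
        (∀ v w : E4, 𝒟.metric.val (χ' x) (mfderiv 𝓘(ℝ, E4) (𝓡 4) χ' x v)
            (mfderiv 𝓘(ℝ, E4) (𝓡 4) χ' x w) = Kerr.bilin M a (x : E4) v w) ∧
        𝒟.metric.val (χ' x) (𝒟.timeOrientation.vectorField (χ' x))
            (mfderiv 𝓘(ℝ, E4) (𝓡 4) χ' x (Kerr.timeVector M a (x : E4))) < 0) →
      (∀ y : Kerr.slice a r₁, χ' (ψ y) = 𝒟.embed (φ y)) →
      (∀ y : Kerr.slice a r₁, mfderiv 𝓘(ℝ, E4) (𝓡 4) χ' (ψ y) (ν y) = 𝒟.normal (φ y)) →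
      ∃ (E' : Set 𝒟.carrier) (χ : 𝒟.carrier → Kerr.region a (Kerr.rMinus M a)),
        (𝒟.metric.causalFuture 𝒟.timeOrientation (Set.range 𝒟.embed) \
            𝒟.metric.causalFuture 𝒟.timeOrientation (𝒟.embed '' (Set.range φ)ᶜ)) ⊆ E' ∧
        IsOpen E' ∧ ContMDiffOn (𝓡 4) (𝓡 4) ((⊤ : ℕ∞) : WithTop ℕ∞) χ E' ∧ Set.InjOn χ E' ∧
        (∀ p ∈ E',
          (∀ v w, Kerr.bilin M a (χ p : E4) (mfderiv (𝓡 4) (𝓡 4) χ p v)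
              (mfderiv (𝓡 4) (𝓡 4) χ p w) = 𝒟.metric.val p v w) ∧
          (Kerr.spacetime M a (Kerr.rMinus M a) hM).timeOrientation.IsFutureDirected
            (mfderiv (𝓡 4) (𝓡 4) χ p (𝒟.timeOrientation.vectorField p))) ∧
        (∀ x : Kerr.region a r₁,
          0 < (x : E4) 0 - T (Kerr.radius a (x : E4)) + (Kerr.radius a (x : E4) - r₁) / 4 →
          χ' x ∈ E' ∧ (χ (χ' x) : E4) = (x : E4))

/-- **Boyer–Lindquist block II of sub-extremal Kerr has finite timelike diameter**
(`KerrBlackHoleBoundedTimeSeparation`, named fact). For `|a| < M` there is `C = C(M, a)` such that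
in the ingoing Kerr–Schild chart `Kerr.spacetime M a r₋ = ({r > r₋}, g_{M,a}, −g♯dt*)` the time
separation satisfies `d(p, q) ≤ C` for every `p` with `r(p) < r₊` and every `q`: on block II
`{r₋ < r < r₊}` the differential `dr` is timelike (`g⁻¹(dr, dr) = Δ/Σ < 0`), so `r` decreases
strictly along future causal curves, which never leave the block, and the reverse Cauchy–Schwarz
inequality gives `√(−g(v, v)) ≤ √(Σ/|Δ|) |dr(v)|` for causal `v`, with `Σ ≤ r₊² + a²` and
`|Δ| = (r₊ − r)(r − r₋)`; hence every causal curve in the block has length at most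
`∫_{r₋}^{r₊} √((r₊² + a²)/((r₊ − r)(r − r₋))) dr = π √(r₊² + a²)` (and `d(p, q) = 0` if
`q ∉ J⁺(p)`). O'Neill 1995, Ch. 2, §2.5 (the causal character of `r` on block II) with Ch. 4, §4.2;
Hawking–Ellis 1973, §5.6. Named fact (statement only); users take
`(h : KerrBlackHoleBoundedTimeSeparation)`.
[cite: ONeill1995, Ch. 2, §2.5 and Ch. 4, §4.2] [cite: HawkingEllis1973CUP, §5.6] -/
def KerrBlackHoleBoundedTimeSeparation : Prop :=
  ∀ [Kerr.Facts] (M a : ℝ) (hM : 0 ≤ M), |a| < M → ∃ C : ℝ≥0,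
    ∀ p q : Kerr.region a (Kerr.rMinus M a), Kerr.radius a (p : E4) < Kerr.rPlus M a →
      (Kerr.spacetime M a (Kerr.rMinus M a) hM).lorentzDist p q ≤ (C : ℝ≥0∞)

/-- **No future-complete null geodesic of the Kerr chart `{r > r₋}` meets the black-hole interior
`{r < r₊}`** (`KerrBlackHoleNoCompleteNullRay`, named fact). For `|a| < M`: if `γ` is a geodesic of
`g_{M,a}` on `Kerr.region a r₋` defined on a parameter ray `(t₀, ∞)` whose velocity at some `t₁ > t₀`
is null and future-directed (for `−g♯dt*`), then `r(γ t₁) ≥ r₊`. Equivalently, every future-directed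
null geodesic through a point of Boyer–Lindquist block II reaches the Cauchy horizon `{r = r₋}` (leaves
every compact subset of `{r > r₋}`) at FINITE affine parameter: by Carter's first integrals
`Σ² ṙ² = R(r) = ((r² + a²)E − aL)² − Δ(r) K`, `K = Q + (L − aE)² ≥ 0`, the radial potential is
positive on `(r₋, r₊)` (where `Δ < 0`) and has at most a simple zero at `r₋` unless the geodesic is
trivial. O'Neill 1995, Ch. 4, §4.2 (first integrals) and §4.3 (the `r`-motion; block II is one-way);
Hawking–Ellis 1973, §5.6. Named fact (statement only); users take
`(h : KerrBlackHoleNoCompleteNullRay)`.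
[cite: ONeill1995, Ch. 4, §4.2–§4.3] [cite: HawkingEllis1973CUP, §5.6] -/
def KerrBlackHoleNoCompleteNullRay : Prop :=
  ∀ [Kerr.Facts] (M a : ℝ) (hM : 0 ≤ M), |a| < M →
    ∀ [(Kerr.spacetime M a (Kerr.rMinus M a) hM).metric.HasLeviCivita]
      (γ : ℝ → Kerr.region a (Kerr.rMinus M a)) (t₀ t₁ : ℝ), t₀ < t₁ →
      IsGeodesicOn (Kerr.spacetime M a (Kerr.rMinus M a) hM).metric.leviCivita γ (Set.Ioi t₀) →
      (Kerr.spacetime M a (Kerr.rMinus M a) hM).metric.IsNull (velocity (𝓡 4) γ t₁) →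
      (Kerr.spacetime M a (Kerr.rMinus M a) hM).timeOrientation.IsFutureDirected
        (velocity (𝓡 4) γ t₁) →
      Kerr.rPlus M a ≤ Kerr.radius a (γ t₁ : E4)

/-- **Uniform tame charts of the visible Kerr exterior above the bent leaf**
(`KerrVisibleExteriorUniformCharts`, named fact). For `|a| < M`, `r₋ < r₁ < r₊` and the bent height
`T` (pinned to its literal) there is a scale `r_b = r_b(M, a, r₁) > 0` such that for every
`0 < r' ≤ r_b` some bound `Λ` works: for every point `x` of the chart `{r > r₋}` in the causal future
(for `g_{M,a}`, `−g♯dt*`) of the bent leaf `{r > r₁, x⁰ = T(r)}` whose chronological future contains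
a point `z` with `r(z) ≥ r₊` (so that `r(x) > r₊`: no causal curve leaves `{r ≤ r₊}`, O'Neill 1995,
§2.5), there is a linear frame `A ∈ GL(ℝ⁴)` such that the affine coordinate ball `x + A(B(0, r'))`
lies in the tapered collar `W = {r > max(r₁, 0), 0 < x⁰ − T(r) + (r − r₁)/4}` and the components
`A^*g_{M,a}(x + A ·) − η` have `C³` sup norm `≤ Λ` and `C⁰` sup norm `≤ 1/2` on `B(0, r')` (extended
by `0` off the ball, the convention of `Spacetime.deviationExtend`). Sketch: `A` = the inverse
Kerr–Schild shear `v ↦ v − H ℓ(v) ℓ♯` at `x` (`A^*g(x) = η`, `‖A‖ ≤ 1 + 2M/r₊`); `g_{M,a} = η + 2Hℓ⊗ℓ`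
is `t*`-independent with all `x⃗`-derivatives of order `≤ 4` bounded on `{r ≥ r₊}` (rational in
`(x⃗, r)`, `O(M/r)`); `r` and `T∘r` are Lipschitz there; `x⁰ ≥ T(r x)` on the causal future of the leaf
(the translates `{x⁰ = T(r) + c}` are spacelike). O'Neill 1995, Ch. 2, §2.4–§2.5;
Dafermos–Holzegel–Rodnianski–Taylor arXiv:2104.08222, §1 (the Kerr–Schild deviation and its
derivatives). Named fact (statement only); users take `(h : KerrVisibleExteriorUniformCharts)`.
[cite: ONeill1995, Ch. 2, §2.4–§2.5] [cite: arXiv210408222, §1] -/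
def KerrVisibleExteriorUniformCharts : Prop :=
  ∀ [Kerr.Facts] (M a r₁ : ℝ) (hM : 0 ≤ M) (T : ℝ → ℝ), |a| < M → Kerr.rMinus M a < r₁ →
    r₁ < Kerr.rPlus M a →
    T = (fun r : ℝ ↦ Real.smoothTransition (r / (4 * M) - 1) *
      (((M) / Real.sqrt ((M) ^ 2 - (a) ^ 2)) * (Kerr.rPlus M a * Real.log (r - Kerr.rPlus M a) -
        Kerr.rMinus M a * Real.log (r - Kerr.rMinus M a)) -
      ((M) / Real.sqrt ((M) ^ 2 - (a) ^ 2)) * (Kerr.rPlus M a * Real.log ((4 * M) - Kerr.rPlus M a) -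
        Kerr.rMinus M a * Real.log ((4 * M) - Kerr.rMinus M a)))) →
    ∃ rb : ℝ, 0 < rb ∧ ∀ r' : ℝ, 0 < r' → r' ≤ rb → ∃ Λ : ℝ≥0,
      ∀ x z : Kerr.region a (Kerr.rMinus M a),
        x ∈ (Kerr.spacetime M a (Kerr.rMinus M a) hM).metric.causalFuture
            (Kerr.spacetime M a (Kerr.rMinus M a) hM).timeOrientation
            {y : Kerr.region a (Kerr.rMinus M a) |
              r₁ < Kerr.radius a (y : E4) ∧ (y : E4) 0 = T (Kerr.radius a (y : E4))} →
        z ∈ (Kerr.spacetime M a (Kerr.rMinus M a) hM).metric.chronologicalFuture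
            (Kerr.spacetime M a (Kerr.rMinus M a) hM).timeOrientation {x} →
        Kerr.rPlus M a ≤ Kerr.radius a (z : E4) →
        ∃ A : E4 ≃L[ℝ] E4,
          (∀ y ∈ Metric.ball (0 : E4) r',
            max r₁ 0 < Kerr.radius a ((x : E4) + A y) ∧
            0 < ((x : E4) + A y) 0 - T (Kerr.radius a ((x : E4) + A y)) +
              (Kerr.radius a ((x : E4) + A y) - r₁) / 4) ∧
          supCkENorm (Metric.ball (0 : E4) r') 3
            (Function.extend
              (Subtype.val : (⟨Metric.ball (0 : E4) r', Metric.isOpen_ball⟩ :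
                TopologicalSpace.Opens E4) → E4)
              (fun y ↦ (Kerr.bilin M a ((x : E4) + A (y : E4))).bilinearComp
                (A : E4 →L[ℝ] E4) (A : E4 →L[ℝ] E4) - Minkowski.bilin) 0) ≤ (Λ : ℝ≥0∞) ∧
          supCkENorm (Metric.ball (0 : E4) r') 0
            (Function.extend
              (Subtype.val : (⟨Metric.ball (0 : E4) r', Metric.isOpen_ball⟩ :
                TopologicalSpace.Opens E4) → E4)
              (fun y ↦ (Kerr.bilin M a ((x : E4) + A (y : E4))).bilinearComp
                (A : E4 →L[ℝ] E4) (A : E4 →L[ℝ] E4) - Minkowski.bilin) 0) ≤ 1 / 2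

end Literature.Geometry.Lorentzian

end
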